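import Summits.ValiantsHypothesis.ValiantsHypothesis.Theorems.NcFrameSplit
import HarnessLib

/-!
# The lift inequality `B(SOS_{2^r}) ≤ 3·2^r·(4r+1)²·C(LID_r)` (Hrubeš–Wigderson–Yehudayoff, Cor. C.4)

Workshop file for the node `CommutativityDial` (decomp-valiant lens 6; road K5a′, stage 3b-ii towards
the named fact `HWY10_thm_1_7`), on top of `NcFrameSplit` (the frame split and its `Λ_r`-lift),
`NcBlockForms` (`Λ_r`, `LID_r`, `Λ_r(LID_r) = SOS_{2^r}`) and `NcCentralWidth`
(`central_structure_of_size`). CONTENT: in HWY's window `4r ≤ 3e < 8r` some scheme `m ∈ {0,1,2}`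
has `|F Δ G| ≤ r` (`dispatch` — pure arithmetic; HWY's `≤ r` is TIGHT: equality occurs, enumerated
for `r ≤ 60`); so the fixed family is indexed by (gate, `e`, `ρ`, scheme, `t`) of size
`≤ s·(4r+1)²·3·2^r` (`liftIdx`, `card_liftIdx_le`); the LIFT MODULE (`liftModule`: sums
`Σ_j fixed_j(X,Y)·ψ_j(X,Y)`, `ψ_j` vanishing off the index) receives `Λ_r` of every central generator
(`central_mem_liftModule`, frames reduced to words by `word_induction`), hence of the central span
(`cenSpan_le_liftModule` = Proposition C.3 in span form); so a fan-in-two circuit of size `s` for a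
homogeneous `f` of degree `4r` gives `B(Λ_r f) ≤ 3·2^r·(4r+1)²·s` (`blockForm_bilinear_le`), and
`B(SOS_{2^r}) ≤ 3·2^r·(4r+1)²·C(LID_r)` (`sos_bilinear_le_lift` = Corollary C.4), every commutative
ring, every `r ≥ 1`.
CONSTANTS: print records `t = O(d³·s·2^{d/2})` bilinear products for the degree-`d` identity
polynomial (Arvind–Raja, CJTCS 2016, Rem. 4.6, quoting HWY, J. AMS 2011, Cor. 5.4); in the normalisation used here (`d = 4r`, `k = 2^r`) the kernel constant
`3·(4r+1)²·2^r·s` is one factor `r` sharper than the printed `O(d³·2^{d/2}·s)`; nothing else differs.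
HONEST FRAMING: a theorem in print (HWY, STOC 2010, App. C, Prop. C.3 / Cor. C.4 = J. AMS 24 (2011)
§5), kernel-new formalisation over the tree's fan-in-two straight-line model; no lower bound on the
permanent here (Lemma C.5 and Theorem 1.7 are `NcSOSPermanent`); `VP ≠ VNP` untouched.
-/

noncomputable section

namespace Summit.ValiantsHypothesis.ValiantsHypothesis.Theorems.NcSOSLift

open Literature.Computability.AlgebraicComplexity
open Summit.ValiantsHypothesis.ValiantsHypothesis.Theorems.NcCentralWidth
open Summit.ValiantsHypothesis.ValiantsHypothesis.Theorems.NcSOSDegreeFour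
open Summit.ValiantsHypothesis.ValiantsHypothesis.Theorems.NcBlockForms
open Summit.ValiantsHypothesis.ValiantsHypothesis.Theorems.NcFrameSplit
open MvPolynomial (X)

universe u

variable (F : Type u) [CommRing F]

section Count

/-- **Dispatch** (HWY's choice of `k ∈ {λ(x), λ(y)}`): in the window `4r ≤ 3e < 8r` some scheme has
`|F Δ G| ≤ r`.  The bound `r` is attained. [cite: HrubesWigdersonYehudayoff2010, Lemma C.2] -/
theorem dispatch {r ρ e : ℕ} (h1 : 4 * r ≤ 3 * e) (h2 : 3 * e < 8 * r) (h3 : ρ + e ≤ 4 * r) :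
    ∃ m : Fin 3, (m.val * r - ρ) + (ρ - m.val * r) + (m.val * r + 2 * r - (ρ + e)) +
      (ρ + e - (m.val * r + 2 * r)) ≤ r := by
  by_cases hA : e + 2 * ρ ≤ 3 * r
  · refine ⟨⟨0, by norm_num⟩, ?_⟩
    show (0 * r - ρ) + (ρ - 0 * r) + (0 * r + 2 * r - (ρ + e)) + (ρ + e - (0 * r + 2 * r)) ≤ r
    omega
  by_cases hB : e + 2 * (4 * r - ρ - e) ≤ 3 * r
  · refine ⟨⟨2, by norm_num⟩, ?_⟩
    show (2 * r - ρ) + (ρ - 2 * r) + (2 * r + 2 * r - (ρ + e)) + (ρ + e - (2 * r + 2 * r)) ≤ r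
    omega
  · refine ⟨⟨1, by norm_num⟩, ?_⟩
    show (1 * r - ρ) + (ρ - 1 * r) + (1 * r + 2 * r - (ρ + e)) + (ρ + e - (1 * r + 2 * r)) ≤ r
    omega

/-- The INDEX of the fixed family: (gate `ip`, body degree `e`, offset `ρ`, scheme `m`, word `t`),
`e` in HWY's window, `ρ + e ≤ 4r`, a scheme with `|F Δ G| ≤ r`, `t` supported on `F Δ G`.
[cite: HrubesWigdersonYehudayoff2010, Prop. C.3] -/
def liftIdx (r s : ℕ) :
    Finset (Fin s × Fin (4 * r + 1) × Fin (4 * r + 1) × Fin 3 × (Fin (4 * r) → Fin 2)) :=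
  Finset.univ.filter fun j =>
    (4 * r ≤ 3 * j.2.1.val ∧ 3 * j.2.1.val < 8 * r ∧ j.2.2.1.val + j.2.1.val ≤ 4 * r ∧
      (j.2.2.2.1.val * r - j.2.2.1.val) + (j.2.2.1.val - j.2.2.2.1.val * r) +
        (j.2.2.2.1.val * r + 2 * r - (j.2.2.1.val + j.2.1.val)) +
        (j.2.2.1.val + j.2.1.val - (j.2.2.2.1.val * r + 2 * r)) ≤ r) ∧
    ∀ p : Fin (4 * r), ((j.2.2.2.1.val * r ≤ p.val ∧ p.val < j.2.2.2.1.val * r + 2 * r) ↔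
      (j.2.2.1.val ≤ p.val ∧ p.val < j.2.2.1.val + j.2.1.val)) → j.2.2.2.2 p = 0

/-- Membership in the index. [cite: HrubesWigdersonYehudayoff2010, Prop. C.3] -/
theorem mem_liftIdx {r s : ℕ} (ip : Fin s) (e ρ : Fin (4 * r + 1)) (m : Fin 3)
    (t : Fin (4 * r) → Fin 2) : (ip, e, ρ, m, t) ∈ liftIdx r s ↔
      (4 * r ≤ 3 * e.val ∧ 3 * e.val < 8 * r ∧ ρ.val + e.val ≤ 4 * r ∧
        (m.val * r - ρ.val) + (ρ.val - m.val * r) + (m.val * r + 2 * r - (ρ.val + e.val)) +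
          (ρ.val + e.val - (m.val * r + 2 * r)) ≤ r) ∧
      ∀ p : Fin (4 * r), ((m.val * r ≤ p.val ∧ p.val < m.val * r + 2 * r) ↔
        (ρ.val ≤ p.val ∧ p.val < ρ.val + e.val)) → t p = 0 := by
  unfold liftIdx
  rw [Finset.mem_filter]
  exact ⟨fun h => h.2, fun h => ⟨Finset.mem_univ _, h⟩⟩

/-- **The index count** `|liftIdx| ≤ s·(4r+1)²·3·2^r`. [cite: HrubesWigdersonYehudayoff2010, Prop. C.3] -/
theorem card_liftIdx_le (r s : ℕ) : (liftIdx r s).card ≤ s * (4 * r + 1) ^ 2 * 3 * 2 ^ r := by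
  classical
  have fib : ∀ b : Fin s × Fin (4 * r + 1) × Fin (4 * r + 1) × Fin 3,
      ((liftIdx r s).filter fun a => (a.1, a.2.1, a.2.2.1, a.2.2.2.1) = b).card ≤ 2 ^ r := by
    rintro ⟨ip, e, ρ, m⟩
    by_cases hadm : 4 * r ≤ 3 * e.val ∧ 3 * e.val < 8 * r ∧ ρ.val + e.val ≤ 4 * r ∧
        (m.val * r - ρ.val) + (ρ.val - m.val * r) + (m.val * r + 2 * r - (ρ.val + e.val)) +
          (ρ.val + e.val - (m.val * r + 2 * r)) ≤ r
    · refine le_trans (Finset.card_le_card_of_injOn (fun a => a.2.2.2.2) ?_ ?_)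
        ((card_supported_le (4 * r) (m.val * r) ρ.val e.val (2 * r)).trans
          (Nat.pow_le_pow_right (by norm_num) hadm.2.2.2))
      · rintro ⟨ip', e', ρ', m', t⟩ ha
        simp only [Finset.mem_coe, Finset.mem_filter, Prod.mk.injEq] at ha
        obtain ⟨ha1, rfl, rfl, rfl, rfl⟩ := ha
        simp only [Finset.mem_coe, Finset.mem_filter, Finset.mem_univ, true_and]
        exact ((mem_liftIdx ip' e' ρ' m' t).1 ha1).2
      · rintro ⟨ip₁, e₁, ρ₁, m₁, t₁⟩ h₁ ⟨ip₂, e₂, ρ₂, m₂, t₂⟩ h₂ ht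
        simp only [Finset.mem_coe, Finset.mem_filter, Prod.mk.injEq] at h₁ h₂ ⊢
        dsimp only at ht
        exact ⟨h₁.2.1.trans h₂.2.1.symm, h₁.2.2.1.trans h₂.2.2.1.symm,
          h₁.2.2.2.1.trans h₂.2.2.2.1.symm, h₁.2.2.2.2.trans h₂.2.2.2.2.symm, ht⟩
    · rw [Finset.card_eq_zero.2 (Finset.filter_eq_empty_iff.2 ?_)]
      · exact Nat.zero_le _
      · rintro ⟨ip', e', ρ', m', t⟩ ha hb
        simp only [Prod.mk.injEq] at hb
        obtain ⟨rfl, rfl, rfl, rfl⟩ := hb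
        exact hadm ((mem_liftIdx ip' e' ρ' m' t).1 ha).1
  rw [Finset.card_eq_sum_card_fiberwise (s := liftIdx r s) (t := Finset.univ)
    (f := fun a : Fin s × Fin (4 * r + 1) × Fin (4 * r + 1) × Fin 3 × (Fin (4 * r) → Fin 2) =>
      (a.1, a.2.1, a.2.2.1, a.2.2.2.1)) fun _ _ => Finset.mem_univ _]
  refine (Finset.sum_le_sum fun b _ => fib b).trans (le_of_eq ?_)
  simp only [Finset.sum_const, Finset.card_univ, Fintype.card_prod, Fintype.card_fin, smul_eq_mul]
  ring

/-- A sum of products of bilinear forms whose second factors vanish off `S` has bilinear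
complexity `≤ |S|`. [cite: HrubesWigdersonYehudayoff2010, §1.3] -/
theorem bilinearComplexity_sum_le {k : ℕ} {J : Type*} [Fintype J] (S : Finset J)
    (A Ψ : J → Fin k → Fin k → F) (hΨ : ∀ j, j ∉ S → Ψ j = 0) :
    HWY10.bilinearComplexity F (∑ j, HWY10.bilinForm F (A j) * HWY10.bilinForm F (Ψ j)) ≤
      S.card := by
  classical
  unfold HWY10.bilinearComplexity
  refine Nat.sInf_le ⟨fun l => A (S.equivFin.symm l).1, fun l => Ψ (S.equivFin.symm l).1, ?_⟩
  rw [← Finset.sum_subset (Finset.subset_univ S)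
      (fun j _ hj => by rw [hΨ j hj, bilinForm_zero, mul_zero]),
    ← Finset.sum_coe_sort S, ← Equiv.sum_comp S.equivFin.symm]

end Count

section Lift

/-- The LIFT MODULE of a list of gate values: the `F`-span of `fixed_j(X,Y) · ψ(X,Y)`, `j` in the
index, `ψ` arbitrary (as sums with second factors vanishing off the index).
[cite: HrubesWigdersonYehudayoff2010, Prop. C.3] -/
def liftModule (r : ℕ) (vals : List (FreeAlgebra F (Fin 2))) :
    Submodule F (MvPolynomial (Fin (2 ^ r) ⊕ Fin (2 ^ r)) F) where
  carrier := {y | ∃ Ψ : (Fin vals.length × Fin (4 * r + 1) × Fin (4 * r + 1) × Fin 3 ×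
      (Fin (4 * r) → Fin 2)) → Fin (2 ^ r) → Fin (2 ^ r) → F,
    (∀ j, j ∉ liftIdx r vals.length → Ψ j = 0) ∧
    y = ∑ j, HWY10.bilinForm F (fun x y => fixedCoef F r (j.2.2.2.1.val * r) j.2.2.1.val j.2.1.val
        j.2.2.2.2 (degPart (4 * r) j.2.1.val (vals.get j.1)) (blockWord r x y x y)) *
      HWY10.bilinForm F (Ψ j)}
  zero_mem' := ⟨0, fun _ _ => rfl, by
    simp only [Pi.zero_apply, bilinForm_zero, mul_zero, Finset.sum_const_zero]⟩
  add_mem' := by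
    rintro _ _ ⟨Ψ, hΨ, rfl⟩ ⟨Ψ', hΨ', rfl⟩
    refine ⟨Ψ + Ψ', fun j hj => by rw [Pi.add_apply, hΨ j hj, hΨ' j hj, add_zero], ?_⟩
    rw [← Finset.sum_add_distrib]
    exact Finset.sum_congr rfl fun j _ => by rw [Pi.add_apply, bilinForm_add, mul_add]
  smul_mem' := by
    rintro a _ ⟨Ψ, hΨ, rfl⟩
    refine ⟨a • Ψ, fun j hj => by rw [Pi.smul_apply, hΨ j hj, smul_zero], ?_⟩
    rw [Finset.smul_sum]
    exact Finset.sum_congr rfl fun j _ => by rw [Pi.smul_apply, bilinForm_smul, mul_smul_comm]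

/-- A framed body around a gate body lands in the lift module under `Λ_r`.
[cite: HrubesWigdersonYehudayoff2010, Lemma C.2, Prop. C.3] -/
theorem framed_mem_liftModule {r : ℕ} (vals : List (FreeAlgebra F (Fin 2)))
    (ip : Fin vals.length) {e ρ : ℕ} (h1 : 4 * r ≤ 3 * e) (h2 : 3 * e < 8 * r)
    (hρe : ρ + e ≤ 4 * r) (c : Fin (4 * r) → Fin 2) :
    blockForm F r (framed hρe c (degPart (4 * r) e (vals.get ip))) ∈ liftModule F r vals := by
  classical
  obtain ⟨e', rfl⟩ : ∃ e' : Fin (4 * r + 1), e'.val = e := ⟨⟨e, by omega⟩, rfl⟩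
  obtain ⟨ρ', rfl⟩ : ∃ ρ' : Fin (4 * r + 1), ρ'.val = ρ := ⟨⟨ρ, by omega⟩, rfl⟩
  obtain ⟨m, hm⟩ := dispatch (r := r) (ρ := ρ'.val) (e := e'.val) h1 h2 hρe
  have hG : degPart (4 * r) e'.val (degPart (4 * r) e'.val (vals.get ip)) =
      degPart (4 * r) e'.val (vals.get ip) := degPart_idem _ _ _
  have hι : Function.Injective fun t : Fin (4 * r) → Fin 2 => (ip, e', ρ', m, t) :=
    fun t t' h => by simpa using h
  obtain ⟨Ψ, hΨ⟩ : ∃ Ψ : (Fin vals.length × Fin (4 * r + 1) × Fin (4 * r + 1) × Fin 3 ×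
      (Fin (4 * r) → Fin 2)) → Fin (2 ^ r) → Fin (2 ^ r) → F, ∀ j, Ψ j =
      if j.1 = ip ∧ j.2.1 = e' ∧ j.2.2.1 = ρ' ∧ j.2.2.2.1 = m then
        (fun x y => freeCoef F r (m.val * r) ρ'.val e'.val j.2.2.2.2 c (blockWord r x y x y))
      else 0 := ⟨_, fun j => rfl⟩
  refine ⟨Ψ, ?_, ?_⟩
  · rintro ⟨ip₀, e₀, ρ₀, m₀, t⟩ hj
    rw [hΨ]
    split_ifs with hmatch
    · obtain ⟨rfl, rfl, rfl, rfl⟩ := hmatch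
      funext x y
      unfold freeCoef
      rw [if_neg]
      · rfl
      rintro ⟨hsupp, -, -, -⟩
      exact hj ((mem_liftIdx ip₀ e₀ ρ₀ m₀ t).2 ⟨⟨h1, h2, hρe, hm⟩, hsupp⟩)
    · rfl
  · rw [blockForm_framed F m hρe hG c, ← Finset.sum_subset (Finset.subset_univ
      ((Finset.univ : Finset (Fin (4 * r) → Fin 2)).map ⟨_, hι⟩)), Finset.sum_map]
    · refine Finset.sum_congr rfl fun t _ => ?_
      dsimp only [Function.Embedding.coeFn_mk]
      rw [hΨ, if_pos ⟨rfl, rfl, rfl, rfl⟩]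
    · intro j _ hj
      have hne : ¬(j.1 = ip ∧ j.2.1 = e' ∧ j.2.2.1 = ρ' ∧ j.2.2.2.1 = m) := by
        rintro ⟨h₁, h₂, h₃, h₄⟩
        refine hj (Finset.mem_map.2 ⟨j.2.2.2.2, Finset.mem_univ _, ?_⟩)
        simp only [Function.Embedding.coeFn_mk, ← h₁, ← h₂, ← h₃, ← h₄]
      rw [hΨ, if_neg hne, bilinForm_zero, mul_zero]

/-- **Proposition C.3, generators**: `Λ_r (h · G · h̄)` lies in the lift module for every gate body
`G` in HWY's window and all homogeneous `h`, `h̄` of the frame degrees.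
[cite: HrubesWigdersonYehudayoff2010, Prop. C.3] -/
theorem central_mem_liftModule {r : ℕ} (vals : List (FreeAlgebra F (Fin 2)))
    (ip : Fin vals.length) {e ρ : ℕ} (h1 : 4 * r ≤ 3 * e) (h2 : 3 * e < 8 * r)
    (hρe : ρ + e ≤ 4 * r) (h hb : FreeAlgebra F (Fin 2)) :
    blockForm F r (degPart (4 * r) ρ h * degPart (4 * r) e (vals.get ip) *
      degPart (4 * r) (4 * r - e - ρ) hb) ∈ liftModule F r vals := by
  classical
  induction h using word_induction with
  | h0 => rw [map_zero, zero_mul, zero_mul, map_zero]; exact Submodule.zero_mem _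
  | hadd f g hf hg => rw [map_add, add_mul, add_mul, map_add]; exact Submodule.add_mem _ hf hg
  | hw a u =>
    rw [map_smul, degPart_word (show ρ ≤ 4 * r by omega) u]
    by_cases hu : u.length = ρ
    · rw [if_pos hu, smul_mul_assoc, smul_mul_assoc, map_smul]
      refine Submodule.smul_mem _ a ?_
      induction hb using word_induction with
      | h0 => rw [map_zero, mul_zero, map_zero]; exact Submodule.zero_mem _
      | hadd f g hf hg => rw [map_add, mul_add, map_add]; exact Submodule.add_mem _ hf hg
      | hw b v =>
        rw [map_smul, degPart_word (show 4 * r - e - ρ ≤ 4 * r by omega) v]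
        by_cases hv : v.length = 4 * r - e - ρ
        · rw [if_pos hv, mul_smul_comm, map_smul]
          refine Submodule.smul_mem _ b ?_
          obtain ⟨c, hcu, hcv⟩ : ∃ c : Fin (4 * r) → Fin 2,
              u = List.ofFn (fun q : Fin ρ => c ⟨q.val, by have := q.isLt; omega⟩) ∧
              v = List.ofFn (fun q : Fin (4 * r - (ρ + e)) =>
                c ⟨ρ + e + q.val, by have := q.isLt; omega⟩) := by
            refine ⟨fun p => if hp : p.val < ρ then u[p.val]'(by omega) else
              if hp' : ρ + e ≤ p.val then v[p.val - (ρ + e)]'(by have := p.isLt; omega)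
              else 0, ?_, ?_⟩
            · apply List.ext_getElem
              · rw [List.length_ofFn, hu]
              · intro i hi₁ hi₂
                rw [List.getElem_ofFn]; dsimp only
                rw [dif_pos (by omega)]
            · apply List.ext_getElem
              · rw [List.length_ofFn, hv]; omega
              · intro i hi₁ hi₂
                rw [List.getElem_ofFn]; dsimp only
                rw [dif_neg (by omega), dif_pos (by omega)]
                simp only [Nat.add_sub_cancel_left]
          rw [hcu, hcv]
          exact framed_mem_liftModule F vals ip h1 h2 hρe c
        · rw [if_neg hv, smul_zero, mul_zero, map_zero]; exact Submodule.zero_mem _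
    · rw [if_neg hu, smul_zero, zero_mul, zero_mul, map_zero]; exact Submodule.zero_mem _

/-- **Proposition C.3 in span form**: the central span of the gate bodies maps under `Λ_r` into the
lift module. [cite: HrubesWigdersonYehudayoff2010, Prop. C.3] -/
theorem cenSpan_le_liftModule {r : ℕ} (vals : List (FreeAlgebra F (Fin 2))) :
    cenSpan (bodies vals (4 * r)) (4 * r) (4 * r) ≤ (liftModule F r vals).comap (blockForm F r) := by
  rw [cenSpan]
  refine Submodule.span_le.2 ?_
  rintro x ⟨e, ρ, g, h, hb, ⟨p, hp, rfl⟩, h1, h2, heρ, hh, hhb, rfl⟩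
  obtain ⟨ip, rfl⟩ := List.mem_iff_get.1 hp
  rw [SetLike.mem_coe, Submodule.mem_comap, ← hh, ← hhb]
  exact central_mem_liftModule F vals ip h1 (by omega) (by omega) h hb

/-- **Proposition C.3 / Corollary C.4 for a homogeneous `f` of degree `4r`**: a fan-in-two circuit
of size `s` for `f` gives `B(Λ_r f) ≤ 3·2^r·(4r+1)²·s`. [cite: HrubesWigdersonYehudayoff2010, Prop. C.3] -/
theorem blockForm_bilinear_le {r s : ℕ} (hr : 1 ≤ r) {f : FreeAlgebra F (Fin 2)}
    (hf4 : degPart (4 * r) (4 * r) f = f) (hf : HasNcCircuitSizeLE f s) :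
    HWY10.bilinearComplexity F (blockForm F r f) ≤ 3 * 2 ^ r * (4 * r + 1) ^ 2 * s := by
  classical
  obtain ⟨vals, hlen, hmem⟩ := central_structure_of_size (by omega) hf4 hf
  have hy := cenSpan_le_liftModule F vals hmem
  rw [Submodule.mem_comap] at hy
  obtain ⟨Ψ, hΨ, hy⟩ := hy
  calc HWY10.bilinearComplexity F (blockForm F r f) ≤ (liftIdx r vals.length).card := by
        rw [hy]; exact bilinearComplexity_sum_le F _ _ Ψ hΨ
    _ ≤ vals.length * (4 * r + 1) ^ 2 * 3 * 2 ^ r := card_liftIdx_le r vals.length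
    _ ≤ s * (4 * r + 1) ^ 2 * 3 * 2 ^ r := by gcongr
    _ = 3 * 2 ^ r * (4 * r + 1) ^ 2 * s := by ring

/-- **Corollary C.4** (the lift inequality): `B(SOS_{2^r}) ≤ 3·2^r·(4r+1)²·C(LID_r)` for fan-in-two
noncommutative circuits, every `r ≥ 1`, every commutative ring.
[cite: HrubesWigdersonYehudayoff2010, Cor. C.4] -/
theorem sos_bilinear_le_lift {r s : ℕ} (hr : 1 ≤ r) (hf : HasNcCircuitSizeLE (lidPoly F r) s) :
    HWY10.bilinearComplexity F (HWY10.sosPoly F (2 ^ r)) ≤ 3 * 2 ^ r * (4 * r + 1) ^ 2 * s := by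
  rw [← blockForm_lidPoly F r]
  exact blockForm_bilinear_le F hr (degPart_lidPoly F r) hf

end Lift

end Summit.ValiantsHypothesis.ValiantsHypothesis.Theorems.NcSOSLift

end
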